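import Summits.CriticalPhenomena.Ising3DConformalLimit.Theses.FKParityRobustness

/-!
# Census s4 — typed decomposition attempt for `IndependentStrandsJoin` (NOT filed)

Strategist seat `cstrat-stmt-CriticalPhenomena-14625-s4`.  This file only TYPES the best k = 3 split
found in the census (`STRATEGY-CENSUS-s4.md`, § Decomposition): a self-normalised second-moment
split on the strand clusters of the two independent T-joins.  No piece has a plan (see the census),
so the assembly is deliberately NOT proved and nothing here is registered.
-/

open Literature.Probability.LatticeModels SimpleGraph Finset
open scoped Classical

noncomputable section

namespace Summit.CriticalPhenomena.Ising3DConformalLimit.Cruxes.IndependentStrandsJoin.CensusS4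

/-- The regular lattice tetrahedron of the crux. -/
def tetra : Fin 4 → Site 3 := ![![-1, -1, -1], ![1, 1, -1], ![1, -1, 1], ![-1, 1, 1]]

/-- Vertices of the free box `Λ_N`. -/
abbrev BoxV (N : ℕ) := ↥(box 3 N)

/-- The free-boundary box graph of the crux. -/
def boxGraph (N : ℕ) : SimpleGraph (BoxV N) := (zdGraph 3).comap Subtype.val

/-- `t_c = tanh β_c(3)`. -/
def tc : ℝ := Real.tanh (criticalBeta 3)

/-- Sourced loop-O(1) partition function `Z^{xy}` in the box. -/
def Zpair (N : ℕ) (x y : BoxV N) : ℝ := loopO1PartitionFunction (boxGraph N) tc {x, y}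

/-- Strand-cluster one-point mass `Σ_{F ∈ 𝒯(xy)} t_c^{|F|} 1[x ↝_F u]`. -/
def strandMass (N : ℕ) (x y u : BoxV N) : ℝ :=
  ∑ F ∈ tJoins (boxGraph N) Set.univ {x, y},
    if (fromEdgeSet (↑F : Set (Sym2 (BoxV N)))).Reachable x u then tc ^ F.card else 0

/-- Strand-cluster two-point mass `Σ_{F ∈ 𝒯(xy)} t_c^{|F|} 1[x ↝_F u, x ↝_F v]`. -/
def strandPairMass (N : ℕ) (x y u v : BoxV N) : ℝ :=
  ∑ F ∈ tJoins (boxGraph N) Set.univ {x, y},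
    if (fromEdgeSet (↑F : Set (Sym2 (BoxV N)))).Reachable x u ∧
        (fromEdgeSet (↑F : Set (Sym2 (BoxV N)))).Reachable x v then tc ^ F.card else 0

/-- Strand density `d(u) = ℓ^{xy}[u ∈ V(K_x)]`. -/
def strandDensity (N : ℕ) (x y u : BoxV N) : ℝ := strandMass N x y u / Zpair N x y

/-- Strand pair density `ℓ^{xy}[u, v ∈ V(K_x)]`. -/
def strandPairDensity (N : ℕ) (x y u v : BoxV N) : ℝ := strandPairMass N x y u v / Zpair N x y

/-- The self-normalising profile `m_N(r)`: strand density at the centre `0` of the scale-`r`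
tetrahedral placement (the set below is a singleton when the placement fits in the box, else empty,
and `sSup ∅ = 0`). No exponent is hard-coded: this is the object's OWN one-arm function. -/
def centreDensity (N r : ℕ) : ℝ :=
  sSup {d : ℝ | ∃ a : Fin 4 → BoxV N, ∃ c : BoxV N,
    (∀ i, ((a i : Site 3)) = (r : ℤ) • tetra i) ∧ ((c : Site 3)) = 0 ∧
    d = strandDensity N (a 0) (a 1) c}

/-- Piece 1 — WINDOW FLOOR (Harnack-type placement regularity of the strand cluster): inside the
window `‖u‖∞ ≤ l/2` the strand density of either configuration is at least a constant times the
centre profile, uniformly in `l`. -/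
def StrandWindowFloor : Prop :=
  ∃ c : ℝ, 0 < c ∧ ∀ l : ℕ, 1 ≤ l → ∃ N₀ : ℕ, ∀ N : ℕ, N₀ ≤ N → ∀ a : Fin 4 → BoxV N,
    (∀ i, ((a i : Site 3)) = (l : ℤ) • tetra i) → ∀ u : BoxV N,
      (∀ i, 2 * |(u : Site 3) i| ≤ (l : ℤ)) →
        c * centreDensity N l ≤ strandDensity N (a 0) (a 1) u ∧
        c * centreDensity N l ≤ strandDensity N (a 2) (a 3) u

/-- Piece 2 — QUASI-MULTIPLICATIVITY of the strand cluster (two-point ceiling, self-normalised):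
`ℓ[u, v ∈ K] ≤ C · ℓ[u ∈ K] · m_N(r)` whenever `‖u − v‖∞ ≍ r`, for window points. -/
def StrandQuasiMult : Prop :=
  ∃ C : ℝ, ∀ l : ℕ, 1 ≤ l → ∃ N₀ : ℕ, ∀ N : ℕ, N₀ ≤ N → ∀ a : Fin 4 → BoxV N,
    (∀ i, ((a i : Site 3)) = (l : ℤ) • tetra i) → ∀ u v : BoxV N, ∀ r : ℕ, 1 ≤ r →
      (∀ i, 2 * |(u : Site 3) i| ≤ (l : ℤ)) → (∀ i, 2 * |(v : Site 3) i| ≤ (l : ℤ)) →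
      (∀ i, |(u : Site 3) i - (v : Site 3) i| ≤ (r : ℤ)) → (∃ i, (r : ℤ) ≤ 2 * |(u : Site 3) i - (v : Site 3) i|) →
        strandPairDensity N (a 0) (a 1) u v ≤ C * strandDensity N (a 0) (a 1) u * centreDensity N r ∧
        strandPairDensity N (a 2) (a 3) u v ≤ C * strandDensity N (a 2) (a 3) u * centreDensity N r

/-- Piece 3 — STRAND HYPERSCALING (the exponent inequality `D_HT > 3/2` in integrated,
self-normalised form): the window sum `Σ_{r ≤ 2l} r² m_N(r)²` is dominated by its top scale. -/
def StrandHyperscaling : Prop :=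
  ∃ C : ℝ, ∀ l : ℕ, 1 ≤ l → ∃ N₀ : ℕ, ∀ N : ℕ, N₀ ≤ N →
    (∑ r ∈ Finset.range (2 * l + 1), ((r : ℝ) + 1) ^ 2 * centreDensity N r ^ 2)
      ≤ C * (l : ℝ) ^ 3 * centreDensity N l ^ 2

/-- The assembly the split would need (Paley–Zygmund on `N = #(V(K₁) ∩ V(K₂) ∩ window)` under
`ℓ^{a₀a₁} ⊗ ℓ^{a₂a₃}`, `{N > 0} ⊆ {a₀ ↝_{F₁ ∪ F₂} a₂}`).  Stated, NOT proved (no piece has a plan). -/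
def AssemblyClaim : Prop :=
  StrandWindowFloor → StrandQuasiMult → StrandHyperscaling →
    Summit.CriticalPhenomena.Ising3DConformalLimit.Theses.FKParityRobustness.IndependentStrandsJoin

end Summit.CriticalPhenomena.Ising3DConformalLimit.Cruxes.IndependentStrandsJoin.CensusS4

end
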